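import Summits.Ventures.Crystal3D.Theorems.StickyWulffConstantTextureBuildMesh
import Summits.Ventures.Crystal3D.Theorems.StickyWulffConstantTextureBuildBarlowShells
import HarnessLib

/-!
# TB-D assembly, part 9: the COVERING KIT — how a facet point gets into the closure of the OTHER pieces
# (lane T, crux `TextureLiminfV5`, stmt-Ventures-23912; repair census HOME/wulff-p2/g20/TB-D-1-g20.md §2 (c); brick B2)

HONEST FRAMING. Venture `Summits/Ventures/Crystal3D` (cell `crystal3d-full`), route `route-Ventures-StickyWulffConstant`, helper `--supports` the
law-v5 crux `TextureLiminfV5` (stmt-Ventures-23912).  Elementary topology / measure lemmas (census-free, standard axioms) used by every «covered ✓» row of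
the census of the `PieceData` construction behind `stub_TB_energy`; nothing about the cover's combinatorics; F-C1 not moved.

In the piece ledger a facet point `y` of a piece costs nothing iff `y ∈ cl P'` for ANOTHER piece `P'`.  The census derives this from the mesh's matching
clauses, which say what MATERIAL lies across; the material is a.e. a union of pieces.  The kit:
* `subset_closure_of_ae_subset` — an open set that is a.e. inside `A` lies inside `closure A` (positive measure of small balls);
* `mem_closure_of_open_ae_subset` — hence a point in the closure of such an open set is in `closure A`;
* `exists_mem_closure_of_mem_closure_biUnion` — the closure of a finite union is the union of the closures (pick the piece);
* `solidAt_of_dense` — `SolidAt f` (all stacking sites within `√2` are tent atoms) propagates from the complement of a closed set with empty interior to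
  the whole open set: a violating point brings a vacant site `b` and the open ball `ball b √2`, which meets the good set;
* `setOf_solidAt_eq` — `{z | SolidAt f z}` IS the «full region» of `BarlowFreeCertificate`'s mass clause (`{y | ∀ b ∈ S, dist y b ≤ √2 → b ∈ X}`), so an
  open set of solid points is a.e. inside the tent solid `G`, hence inside `closure G` (`subset_closure_tent_of_solid`);
* `exists_tent_atom_near_of_solidAt` / `not_emptyAt_of_solidAt_near` — a solid point has a tent atom within `√(1/2)` (covering radius of a Barlow stacking,
  …TextureBuildBarlowShells p710715), so no point within `√2 − √(1/2)` of it is `EmptyAt`; `not_mem_closure_of_emptyAt` — an `EmptyAt` point is not in the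
  closure of any set carried within `√2` of the tent atoms (the tent solid).
-/

noncomputable section

namespace Summit.Ventures.Crystal3D.Cruxes.TextureLiminf.TexShadow

open Summit.Ventures.Crystal3D Summit.Ventures.Crystal3D.Theorems MeasureTheory Set
open scoped InnerProductSpace ENNReal

/-! ### Open sets a.e. inside a set -/

/-- **An open set a.e. inside `A` lies in `closure A`.** -/
theorem subset_closure_of_ae_subset {O A : Set E3} (hO : IsOpen O) (hae : volume (O \ A) = 0) : O ⊆ closure A := by
  intro x hx
  rw [Metric.mem_closure_iff]
  intro ε hε
  by_contra hno
  push Not at hno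
  -- the ball `ball x ε ∩ O` misses `A`, but has positive measure
  obtain ⟨r, hr, hball⟩ := Metric.isOpen_iff.1 hO x hx
  have hsub : Metric.ball x (min r ε) ⊆ O \ A := by
    intro z hz
    have hz' := Metric.mem_ball.1 hz
    refine ⟨hball (Metric.mem_ball.2 (lt_of_lt_of_le hz' (min_le_left _ _))), fun hzA => ?_⟩
    have := hno z hzA
    rw [dist_comm] at hz'
    linarith [min_le_right r ε]
  have hpos : 0 < volume (Metric.ball x (min r ε)) := Metric.measure_ball_pos volume x (lt_min hr hε)
  have hle : volume (Metric.ball x (min r ε)) ≤ volume (O \ A) := measure_mono hsub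
  rw [hae] at hle
  exact absurd (le_antisymm hle bot_le) hpos.ne'

/-- A point of the closure of an open set that is a.e. inside `A` is in `closure A`. -/
theorem mem_closure_of_open_ae_subset {O A : Set E3} (hO : IsOpen O) (hae : volume (O \ A) = 0) {y : E3} (hy : y ∈ closure O) :
    y ∈ closure A :=
  (closure_minimal (subset_closure_of_ae_subset hO hae) isClosed_closure) hy

/-- **Pick the piece**: a point in the closure of a finite union is in the closure of one of the sets. -/
theorem exists_mem_closure_of_mem_closure_biUnion {ι : Type*} (s : Finset ι) (P : ι → Set E3) {y : E3}
    (hy : y ∈ closure (⋃ i ∈ s, P i)) : ∃ i ∈ s, y ∈ closure (P i) := by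
  classical
  induction s using Finset.induction_on with
  | empty => simp at hy
  | @insert a s ha ih =>
    rw [Finset.set_biUnion_insert, closure_union] at hy
    rcases hy with h | h
    · exact ⟨a, Finset.mem_insert_self _ _, h⟩
    · obtain ⟨i, hi, hyi⟩ := ih h
      exact ⟨i, Finset.mem_insert_of_mem hi, hyi⟩

/-- The `Fintype` form. -/
theorem exists_mem_closure_of_mem_closure_iUnion {ι : Type*} [Fintype ι] (P : ι → Set E3) {y : E3}
    (hy : y ∈ closure (⋃ i, P i)) : ∃ i, y ∈ closure (P i) := by
  have h : (⋃ i, P i) = ⋃ i ∈ (Finset.univ : Finset ι), P i := by simp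
  rw [h] at hy
  obtain ⟨i, -, hi⟩ := exists_mem_closure_of_mem_closure_biUnion Finset.univ P hy
  exact ⟨i, hi⟩

/-! ### Solidity -/

namespace CellCover

variable {C R₀ : ℝ} {N : ℕ} {x : Fin N → E3}

/-- `{z | SolidAt f z}` is the «full region» of the certificate's mass clause. -/
theorem setOf_solidAt_eq (cv : CellCover C R₀ N x) (f : Fin cv.ng) :
    {z : E3 | cv.SolidAt f z} = {y : E3 | ∀ b ∈ cv.S f, dist y b ≤ Real.sqrt 2 → b ∈ (cv.tent f).Xh} := rfl

/-- **Solidity propagates across a closed set with empty interior**: if every point of the open set `O` off the closed set `Nc` (with `interior Nc = ∅`)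
is `f`-solid, then every point of `O` is. -/
theorem solidAt_of_dense (cv : CellCover C R₀ N x) (f : Fin cv.ng) {O Nc : Set E3} (hO : IsOpen O) (hNc : IsClosed Nc)
    (hNi : interior Nc = ∅) (h : ∀ w ∈ O, w ∉ Nc → cv.SolidAt f w) : ∀ z ∈ O, cv.SolidAt f z := by
  intro z hz b hb hzb
  by_contra hbX
  -- the open set `O ∩ ball b √2 ∖ Nc` is nonempty: it contains points near `z` on the segment towards `b`
  have hopen : IsOpen ((O ∩ Metric.ball b (Real.sqrt 2)) \ Nc) := (hO.inter Metric.isOpen_ball).sdiff hNc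
  -- a point of `O ∩ ball b √2`: move `z` slightly towards `b` (or take `z` itself if `z = b`)
  have hne : (O ∩ Metric.ball b (Real.sqrt 2)).Nonempty := by
    obtain ⟨r, hr, hball⟩ := Metric.isOpen_iff.1 hO z hz
    have h2 : (0 : ℝ) < Real.sqrt 2 := by positivity
    by_cases hzb0 : z = b
    · exact ⟨z, hz, by rw [hzb0]; exact Metric.mem_ball_self h2⟩
    · -- `w = z + t (b - z)` with small `t > 0`
      have hdpos : 0 < dist z b := dist_pos.2 hzb0
      set t : ℝ := min (1 / 2) (r / (2 * dist z b)) with ht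
      have ht0 : 0 < t := lt_min (by norm_num) (by positivity)
      have ht1 : t ≤ 1 / 2 := min_le_left _ _
      set w : E3 := z + t • (b - z) with hw
      refine ⟨w, hball ?_, ?_⟩
      · rw [Metric.mem_ball, hw, dist_eq_norm, add_sub_cancel_left, norm_smul, Real.norm_eq_abs, abs_of_pos ht0, ← dist_eq_norm, dist_comm]
        have hle : t * dist z b ≤ r / 2 :=
          calc t * dist z b ≤ r / (2 * dist z b) * dist z b := mul_le_mul_of_nonneg_right (min_le_right _ _) dist_nonneg
            _ = r / 2 := by field_simp
        linarith
      · rw [Metric.mem_ball, hw, dist_eq_norm]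
        have : z + t • (b - z) - b = (1 - t) • (z - b) := by
          simp only [sub_smul, one_smul, smul_sub]; abel
        rw [this, norm_smul, Real.norm_eq_abs, abs_of_pos (by linarith), ← dist_eq_norm]
        calc (1 - t) * dist z b ≤ (1 - t) * Real.sqrt 2 := mul_le_mul_of_nonneg_left hzb (by linarith)
          _ < 1 * Real.sqrt 2 := mul_lt_mul_of_pos_right (by linarith) h2
          _ = Real.sqrt 2 := one_mul _
  -- it is not inside `Nc` (empty interior), so it has a point off `Nc`
  have hne' : ((O ∩ Metric.ball b (Real.sqrt 2)) \ Nc).Nonempty := by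
    by_contra hem
    rw [Set.not_nonempty_iff_eq_empty] at hem
    have hsub : O ∩ Metric.ball b (Real.sqrt 2) ⊆ Nc := by
      intro w hw
      by_contra hwN
      have : w ∈ (O ∩ Metric.ball b (Real.sqrt 2)) \ Nc := ⟨hw, hwN⟩
      rw [hem] at this
      exact this
    obtain ⟨w, hw⟩ := hne
    have hint : w ∈ interior Nc := interior_maximal hsub (hO.inter Metric.isOpen_ball) hw
    rw [hNi] at hint
    exact hint
  obtain ⟨w, ⟨hwO, hwb⟩, hwN⟩ := hne'
  exact hbX (h w hwO hwN b hb (Metric.mem_ball.1 hwb).le)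

/-- **An open set of solid points lies in the closure of the tent solid** (given the certificate's mass clause for that solid). -/
theorem subset_closure_tent_of_solid (cv : CellCover C R₀ N x) (f : Fin cv.ng) {O G : Set E3} (hO : IsOpen O)
    (hsolid : ∀ z ∈ O, cv.SolidAt f z)
    (hmass : volume ({y : E3 | ∀ b ∈ cv.S f, dist y b ≤ Real.sqrt 2 → b ∈ (cv.tent f).Xh} \ G) = 0) :
    O ⊆ closure G := by
  refine subset_closure_of_ae_subset hO (measure_mono_null (fun z hz => ?_) hmass)
  exact ⟨fun b hb hzb => hsolid z hz.1 b hb hzb, hz.2⟩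

/-! ### Solid versus empty -/

/-- A solid point has a tent atom within `√(1/2)`. -/
theorem exists_tent_atom_near_of_solidAt (cv : CellCover C R₀ N x) (f : Fin cv.ng) {z : E3} (hz : cv.SolidAt f z) :
    ∃ b ∈ (cv.tent f).Xh, dist z b ^ 2 ≤ 1 / 2 := by
  obtain ⟨b, hb, hd⟩ := exists_mem_stacking_dist_sq_le_half (cv.tent f).L (cv.tent f).s (cv.tent f).σ z
  refine ⟨b, hz b hb ?_, hd⟩
  have h2 : Real.sqrt 2 ^ 2 = 2 := Real.sq_sqrt (by norm_num)
  nlinarith [dist_nonneg (x := z) (y := b), Real.sqrt_nonneg 2]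

/-- **No `EmptyAt` point near a solid point**: `SolidAt f z`, `dist y z ≤ 1/2` ⇒ `¬ EmptyAt f y`. -/
theorem not_emptyAt_of_solidAt_near (cv : CellCover C R₀ N x) (f : Fin cv.ng) {y z : E3} (hz : cv.SolidAt f z) (hyz : dist y z ≤ 1 / 2) :
    ¬ cv.EmptyAt f y := by
  intro hE
  obtain ⟨b, hb, hd⟩ := exists_tent_atom_near_of_solidAt cv f hz
  have h1 := hE b hb
  have htri : dist y b ≤ dist y z + dist z b := dist_triangle _ _ _
  have hzb : dist z b ≤ 3 / 4 := by nlinarith [dist_nonneg (x := z) (y := b)]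
  have h2 : (5 / 4 : ℝ) < Real.sqrt 2 := by
    rw [show (5 / 4 : ℝ) = Real.sqrt ((5 / 4) ^ 2) by rw [Real.sqrt_sq (by norm_num)]]
    exact Real.sqrt_lt_sqrt (by norm_num) (by norm_num)
  linarith

/-- **An `EmptyAt` point is outside the closure of anything carried within `√2` of the tent atoms** (e.g. the tent solid). -/
theorem not_mem_closure_of_emptyAt (cv : CellCover C R₀ N x) (f : Fin cv.ng) {y : E3} (hE : cv.EmptyAt f y) {G : Set E3}
    (hG : G ⊆ ⋃ a ∈ (cv.tent f).Xh, Metric.closedBall a (Real.sqrt 2)) : y ∉ closure G := by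
  have hcl : IsClosed (⋃ a ∈ (cv.tent f).Xh, Metric.closedBall a (Real.sqrt 2)) :=
    isClosed_biUnion_finset fun _ _ => Metric.isClosed_closedBall
  intro hy
  have hy' := (closure_minimal hG hcl) hy
  obtain ⟨a, ha, hya⟩ := mem_iUnion₂.1 hy'
  have h1 := hE a ha
  rw [Metric.mem_closedBall] at hya
  linarith

end CellCover

end Summit.Ventures.Crystal3D.Cruxes.TextureLiminf.TexShadow

end
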